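import Summits.ABC.IUTFork.Repair.RHReachLedgerDoorGenuineTiesUnit
import Literature.IUT.LogVolume.UnitLogTieNotAttained
import HarnessLib

/-!
# R-H ROUND 2, row 27 «reach-ledger» — THE NEGATIVE SIDE OF THE RESIDUAL: at a bad place of CYCLOTOMIC TYPE the outer certificate of
# the row-27 door at the ledger's column `B ≤ rOutSharp` DOES NOT EXIST (kernel), so there (O″) is necessary, not only sufficient

PROOF-ONLY file (0 definitions, 0 `Prop` facts; abc-iut cell, D-0079 RESCUE sub-cell R-H, rung LADDER-ABC:A2.RESCUE.H; ROUND-2 seat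
abc-iut-rh2-L1 gen 2). TAKES NO SIDE on [IUTchIII] Cor. 3.12 or on any author; typed ≠ proved; nothing here asserts abc proved or refuted;
row 27's ledger (abc-iut-lens-nearmiss-1, p464022) is an R-H CANDIDATE = a HYPOTHESIS SHAPE.

The doors of this lineage (`statement_of_hStarReachLedger_on`, …, `statement_pilotDataOfK_of_hStarReachLedgerK_of_innerOuterUnit`) consume
at every place `x` over a bad prime `p` an OUTER CERTIFICATE «a log-unit `z ∈ log_p(𝒪_x^×)` with `‖z‖ ≥ p^{−B_p/e_p}`» at a column value
`B_p ≤ rOutSharp p e_p = min_t (p^t − t·e_p)`. `RHReachLedgerDoorGenuineTiesUnit` supplies it on a cyclotomic index `e_p = p^a(p−1)` from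
«`f ≥ 2` or ONE uniformizer `π` with `‖1 + π^{e_p}/p‖ = 1`». THIS FILE proves the CONVERSE at such an index: if EVERY element of uniformizer
norm fails the unit test (CYCLOTOMIC TYPE — `ℚ_p(ζ_p)`-like, residue of `π^e/p` equal to `−1`), then NO such certificate exists for ANY
`B ≤ rOutSharp p e_p` (`not_exists_outer_certificate_of_cyclotomicType`), by the classical converse read-out
`ValuationProfile.norm_le_zpow_succ_of_mem_logUnits_of_cyclotomicType` (`Literature/IUT/LogVolume/UnitLogTieNotAttained.lean`: every unit
logarithm lies one step INSIDE the envelope `‖ϖ‖^{p^a − e·a}`) and `rOutSharp ≤ p^a − a·e` (the fold's term `t = a`, §0). So the residual of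
row 27's certificate binder recorded in `RHReachLedgerQ2GenuineTiesUnit` is kernel-exact on BOTH sides: at a cyclotomic-type bad place the
rOutSharp-door is dead and only a corrected COLUMN (the field's true outer order `≥ B♯ + 1`) could revive the ledger there — a statement about
OUR typed objects, not about [IUTchIII]. [cite: NeukirchANT1999, Ch. II (5.5)–(5.7), Prop. (6.8)] [cite: Washington1997, §5.1]
[claim: Mochizuki2012, status: disputed]
-/

noncomputable section

open Set Function Metric
open scoped Pointwise

namespace Summit.ABC.IUTFork.Repair.RH.ReachLedgerDoor

open Thm311 Thm311.Real Cor312 Cor312.Setting Cor312Vol Cor312Prov Literature.IUT.LogThetaLattice Literature.IUT.LogVolume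
  Literature.IUT.HodgeTheaters Summit.ABC.IUTFork.Repair.RH.ReachLedger
open Literature.NumberTheory.NumberFields NumberField IsDedekindDomain
open Literature.NumberTheory.GaloisRepresentations.Ultrametric

/-! ## §0. The fold `rOutSharp` is below each of its terms -/

/-- `List.foldl min a l` is below the seed and below every member. [folklore] -/
theorem foldl_min_le (l : List ℤ) (a : ℤ) : l.foldl min a ≤ a ∧ ∀ x ∈ l, l.foldl min a ≤ x := by
  induction l generalizing a with
  | nil => exact ⟨le_rfl, fun x hx => by simp at hx⟩
  | cons y l ih =>
    rw [List.foldl_cons]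
    refine ⟨(ih _).1.trans (min_le_left _ _), fun x hx => ?_⟩
    rcases List.mem_cons.mp hx with rfl | hx
    · exact (ih _).1.trans (min_le_right _ _)
    · exact (ih _).2 x hx

/-- **`rOutSharp p e ≤ p^t − t·e` for every `t ≤ e`** (the fold runs over `t = 0, …, e`). [cite: NeukirchANT1999, Ch. II (5.5)] -/
theorem rOutSharp_le_term (p e t : ℕ) (ht : t ≤ e) : rOutSharp p e ≤ (p : ℤ) ^ t - (t : ℤ) * (e : ℤ) := by
  unfold rOutSharp
  refine (foldl_min_le _ 1).2 _ (List.mem_map.mpr ⟨t, List.mem_range.mpr (by omega), rfl⟩)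

/-- At a cyclotomic index `e = p^a·(p−1)` one has `a ≤ e` (indeed `a < p^a ≤ e`). [folklore] -/
theorem le_of_eq_pow_mul_pred {p : ℕ} (hp : p.Prime) {e a : ℕ} (he : e = p ^ a * (p - 1)) : a ≤ e := by
  have h1 : a < p ^ a := Nat.lt_pow_self hp.one_lt
  have h2 : 1 ≤ p - 1 := by have := hp.two_le; omega
  have h3 : p ^ a ≤ e := by rw [he]; exact Nat.le_mul_of_pos_right _ h2
  omega

/-! ## §1. No outer certificate at the ledger's column on a cyclotomic-type place -/

section CyclotomicType

variable {F : Type} [Field F] [NumberField F] (X : PilotData F)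

/-- **NO OUTER CERTIFICATE AT A CYCLOTOMIC-TYPE PLACE.** Let `x ∣ p` be a fibre point of a pilot datum with `e(𝔭_x ∣ p) = e = p^a·(p−1)` and
suppose EVERY `π ∈ K_x` of uniformizer norm `p^{−1/e}` fails the unit test, `‖1 + π^e/p‖ < 1` (cyclotomic type). Then for every column value
`B ≤ rOutSharp p e` there is NO log-unit `z ∈ log_p(𝒪_x^×)` with `p^{−B/e} ≤ ‖z‖` — the binder `hrad ∧ hB` of the row-27 doors is unsatisfiable
there (`ValuationProfile.norm_le_zpow_succ_of_mem_logUnits_of_cyclotomicType`: `‖z‖ ≤ ‖ϖ‖^{p^a − e·a + 1} < ‖ϖ‖^{p^a − e·a} ≤ p^{−B/e}`, since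
`B ≤ rOutSharp ≤ p^a − a·e`). [cite: NeukirchANT1999, Ch. II (5.5)–(5.7), Prop. (6.8)] [cite: Washington1997, §5.1] -/
theorem not_exists_outer_certificate_of_cyclotomicType (pp : Nat.Primes) (x : (thetaIndex X).Fibre (.inr pp)) {e a : ℕ}
    (he : e = (pp : ℕ) ^ a * ((pp : ℕ) - 1))
    (hex : haveI : Fact (pp : ℕ).Prime := ⟨pp.2⟩; (placeOf X pp.1 x).asIdeal.ramificationIdx ℤ = e)
    (hcyc : haveI : Fact (pp : ℕ).Prime := ⟨pp.2⟩
      ∀ π : kOf X pp.1 x, ‖π‖ = ((pp : ℕ) : ℝ) ^ (-(1 : ℝ) / (e : ℝ)) →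
        ‖1 + π ^ e / ((pp : ℕ) : kOf X pp.1 x)‖ < 1)
    {B : ℤ} (hB : B ≤ rOutSharp pp e) :
    haveI : Fact (pp : ℕ).Prime := ⟨pp.2⟩
    ¬ ∃ z ∈ (logUnits (kOf X pp.1 x) : Set (kOf X pp.1 x)), ((pp : ℕ) : ℝ) ^ (-(B : ℝ) / (e : ℝ)) ≤ ‖z‖ := by
  haveI : Fact (pp : ℕ).Prime := ⟨pp.2⟩
  rintro ⟨z, hz, hle⟩
  have hp1 : (1 : ℝ) ≤ ((pp : ℕ) : ℝ) := by exact_mod_cast pp.2.one_le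
  have hu : IsUniformizer (unifChoice (kOf X pp.1 x)) := isUniformizer_unifChoice _
  have hidx : absRamificationIdx (pp : ℕ) (kOf X pp.1 x) = e :=
    (absRamificationIdx_rescaledCompletion F pp.1 (placeOf X pp.1 x) (natCast_mem_placeOf X pp.1 x)).trans hex
  have hnorm : ‖(unifChoice (kOf X pp.1 x) : kOf X pp.1 x)‖ = ((pp : ℕ) : ℝ) ^ (-(1 : ℝ) / (e : ℝ)) := by
    rw [norm_eq_rpow_of_isUniformizer (pp : ℕ) (kOf X pp.1 x) hu, hidx, neg_div]
  -- the classical converse read-out: `‖z‖ ≤ ‖ϖ‖^{p^a − e·a + 1}`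
  have hmain := ValuationProfile.norm_le_zpow_succ_of_mem_logUnits_of_cyclotomicType (pp : ℕ) hu (a₀ := a)
    (by rw [hidx, he]) (fun π hπ => by rw [← he]; exact hcyc π (hπ.trans hnorm)) hz
  rw [hidx] at hmain
  -- `B ≤ rOutSharp ≤ p^a − a·e`
  have hBa : B ≤ ((pp : ℕ) : ℤ) ^ a - (e : ℤ) * (a : ℤ) := by
    have h := rOutSharp_le_term pp e a (le_of_eq_pow_mul_pred pp.2 he)
    linarith [mul_comm (e : ℤ) (a : ℤ)]
  -- compare: `p^{−B/e} ≥ p^{−(p^a − e·a)/e} = ‖ϖ‖^{p^a − e·a} > ‖ϖ‖^{p^a − e·a + 1} ≥ ‖z‖`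
  have hρ0 : 0 < ‖(unifChoice (kOf X pp.1 x) : kOf X pp.1 x)‖ := norm_units_pos _
  have h1 : ‖(unifChoice (kOf X pp.1 x) : kOf X pp.1 x)‖ ^ (((pp : ℕ) : ℤ) ^ a - (e : ℤ) * (a : ℤ)) ≤
      ((pp : ℕ) : ℝ) ^ (-(B : ℝ) / (e : ℝ)) := by
    rw [RH2SigmaHull.zpow_of_norm_eq_rpow pp.2.pos hnorm]
    refine Real.rpow_le_rpow_of_exponent_le hp1 (div_le_div_of_nonneg_right ?_ (by positivity))
    have : (B : ℝ) ≤ ((((pp : ℕ) : ℤ) ^ a - (e : ℤ) * (a : ℤ) : ℤ) : ℝ) := by exact_mod_cast hBa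
    linarith
  have h2 : ‖(unifChoice (kOf X pp.1 x) : kOf X pp.1 x)‖ ^ (((pp : ℕ) : ℤ) ^ a - (e : ℤ) * (a : ℤ) + 1) <
      ‖(unifChoice (kOf X pp.1 x) : kOf X pp.1 x)‖ ^ (((pp : ℕ) : ℤ) ^ a - (e : ℤ) * (a : ℤ)) :=
    zpow_lt_zpow_right_of_lt_one₀ hρ0 hu.1 (lt_add_one _)
  linarith [hmain, hle, h1, h2]

end CyclotomicType

end Summit.ABC.IUTFork.Repair.RH.ReachLedgerDoor

end
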